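import Literature.NumberTheory.EllipticCurves.LocalTorsionAwayFromResidueCharProofs
import Literature.NumberTheory.EllipticCurves.NeronComponentIndexTypeIVExact
import HarnessLib

/-!
# `E(K_v)[p^k] = 0` at a place `v ∤ p` of ADDITIVE reduction with `p ∤ c_v` (Silverman, *AEC* VII.2.1,
# VII.3.1; the `p ∤ c_v` form of `natCard_primePowTorsion_eq_one_of_hasAdditiveReductionAt`)

Topic `NumberTheory/EllipticCurves`; namespace `WeierstrassCurve`. `Proofs`-style file: THEOREMS ONLY (no
definition, no named fact, no instance, no `sorry`). Cell `bsd-print-cf2` (seat ty2), crux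
`CMKolyvaginExactAtInertTwo` (stmt-BirchSwinnertonDyer-24277): the local input "`E(K_v)[2] = 0` at the
places above `p_F`" of the exact local descent of the `2^M`-Selmer condition
(`Summits/…/P2/CMKolyvaginSelmerDescentAtTwoLocal.lean`), where the reduction is additive and `c_v` is odd.

Let `E` be an elliptic curve over a number field `K`, `v` a finite place, `K_v`, `𝓞_v`, `k_v` as in
`LocalTorsionAwayFromResidueCharProofs`, `X = M ⊗ K_v` the chosen minimal model
(`M = E.localMinimalIntegralModel v`), `c_v = c_v(E) = [X(K_v) : E₀(K_v)]` the local Tamagawa number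
(`(E ⊗ K_v).localTamagawaNumber 𝓞_v`, computed on `M` by `LocalIndex.localTamagawaNumber_eq_index_of_smul_eq_baseChange`).

* `natCard_primePowTorsion_dvd_localTamagawaNumber_mul_of_hasAdditiveReductionAt` — at a place of additive
  reduction and for `v ∤ p`: **`#E(K_v)[p^k] ∣ c_v · q_v`** (`#Ẽ_ns(k_v) = q_v` at a cusp,
  `natCard_point_of_Δ_eq_zero`; `natCard_torsion_dvd_index_mul_natCard_reduction`).
* `natCard_primePowTorsion_eq_one_of_hasAdditiveReductionAt_of_not_dvd` — **if moreover `p ∤ c_v` then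
  `E(K_v)[p^k] = 0`** (`#E(K_v)[p^k]` is a power of `p` dividing `c_v q_v`, prime to `p`); the tree's
  `natCard_primePowTorsion_eq_one_of_hasAdditiveReductionAt` is the case `p ≥ 5`, where `p ∤ c_v ≤ 4` is
  automatic, and this form also serves `p = 2, 3`.
* `forall_eq_zero_of_prime_pow_smul_eq_zero_of_hasAdditiveReductionAt_of_not_dvd` — the same as
  "every `P ∈ E(K_v)` with `p^k • P = 0` is `0`".

References: [SilvermanAEC2009] Prop. VII.2.1, Prop. VII.3.1, Thm. VII.6.1; [SilvermanATAEC1994] Cor. IV.9.2(d);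
[Castella2018] Prop. 2.5 (`t_E(w) = ord_p c_w`).
-/

noncomputable section

open scoped Classical

universe u

namespace WeierstrassCurve

open Literature.NumberTheory.EllipticCurves Literature.NumberTheory.GaloisRepresentations
open NumberField IsDedekindDomain IsLocalRing

variable {K : Type u} [Field K] [NumberField K] (E : WeierstrassCurve K) [E.IsElliptic]
variable (v : HeightOneSpectrum (𝓞 K))

/-- `p^k` is a unit of `𝓞_v` when `v ∤ p`. [folklore] -/
private theorem isUnit_natCast_pow_adicCompletionIntegers' {p : ℕ} (hpv : (p : 𝓞 K) ∉ v.asIdeal)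
    (k : ℕ) : IsUnit (((p ^ k : ℕ) : ℕ) : v.adicCompletionIntegers K) := by
  have h := IsDedekindDomain.HeightOneSpectrum.isUnit_algebraMap_adicCompletionIntegers K v hpv
  rw [map_natCast] at h
  rw [Nat.cast_pow]
  exact h.pow k

/-- The order of a finite additive group killed by a power of the prime `p` is prime to every
`m` not divisible by `p` (Cauchy). [folklore] -/
private theorem coprime_natCard_of_prime_pow_nsmul_eq_zero' {T : Type*} [AddCommGroup T] [Finite T]
    {p : ℕ} (hp : p.Prime) {k : ℕ} (hT : ∀ x : T, p ^ k • x = 0) {m : ℕ} (hm : ¬ p ∣ m) :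
    Nat.Coprime (Nat.card T) m := by
  refine Nat.coprime_of_dvd fun q hq hqT hqm => ?_
  haveI : Fact q.Prime := ⟨hq⟩
  obtain ⟨x, hx⟩ := exists_prime_addOrderOf_dvd_card' (G := T) q hqT
  have hdvd : q ∣ p ^ k := by
    rw [← hx]
    exact addOrderOf_dvd_of_nsmul_eq_zero (hT x)
  have hqp : q = p := (Nat.prime_dvd_prime_iff_eq hq hp).mp (hq.dvd_of_dvd_pow hdvd)
  exact hm (hqp ▸ hqm)

omit [E.IsElliptic] in
/-- `p ∤ #k_v` when `v ∤ p`. [folklore] -/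
private theorem not_dvd_natCard_residueField' {p : ℕ} (hp : p.Prime) (hpv : (p : 𝓞 K) ∉ v.asIdeal) :
    ¬ p ∣ Nat.card (ResidueField (v.adicCompletionIntegers K)) := by
  intro hdvd
  haveI := Fintype.ofFinite (ResidueField (v.adicCompletionIntegers K))
  obtain ⟨n, hprime, hcard⟩ :=
    FiniteField.card (ResidueField (v.adicCompletionIntegers K))
      (ringChar (ResidueField (v.adicCompletionIntegers K)))
  rw [Nat.card_eq_fintype_card, hcard] at hdvd
  have hpeq : p = ringChar (ResidueField (v.adicCompletionIntegers K)) :=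
    (Nat.prime_dvd_prime_iff_eq hp hprime).mp (hp.dvd_of_dvd_pow hdvd)
  have h0 : (p : ResidueField (v.adicCompletionIntegers K)) = 0 := by
    rw [hpeq]; exact ringChar.Nat.cast_ringChar
  have hu := IsDedekindDomain.HeightOneSpectrum.isUnit_algebraMap_adicCompletionIntegers K v hpv
  rw [map_natCast] at hu
  have h1 := hu.map (residue (v.adicCompletionIntegers K))
  rw [map_natCast, h0] at h1
  exact not_isUnit_zero h1

/-- **Additive reduction, `v ∤ p`: `#E(K_v)[p^k] ∣ c_v(E) · q_v`** (Silverman, *AEC* VII.2.1, VII.3.1):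
`#X(K_v)[p^k] ∣ [X : E₀] · #Ẽ_ns(k_v)` (`natCard_torsion_dvd_index_mul_natCard_reduction`) with
`[X : E₀] = c_v` on the minimal model (`LocalIndex.localTamagawaNumber_eq_index_of_smul_eq_baseChange`) and
`#Ẽ_ns(k_v) = q_v` at a cusp (`natCard_point_of_Δ_eq_zero`).
[cite: SilvermanAEC2009, Prop. VII.2.1, Prop. VII.3.1] [cite: Castella2018, Prop. 2.5] -/
theorem natCard_primePowTorsion_dvd_localTamagawaNumber_mul_of_hasAdditiveReductionAt
    (hadd : E.HasAdditiveReductionAt v) {p : ℕ} (hpv : (p : 𝓞 K) ∉ v.asIdeal) (k : ℕ) :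
    Nat.card (nsmulAddMonoidHom (p ^ k) : (E.baseChange (v.adicCompletion K)).toAffine.Point →+ _).ker ∣
      (E.baseChange (v.adicCompletion K)).localTamagawaNumber (v.adicCompletionIntegers K) *
        Nat.card (ResidueField (v.adicCompletionIntegers K)) := by
  rw [natCard_torsion_baseChange_eq]
  have h := E.natCard_torsion_dvd_index_mul_natCard_reduction v
    (isUnit_natCast_pow_adicCompletionIntegers' v hpv k)
  obtain ⟨hΔm, hc₄⟩ := (hasAdditiveReductionAt_iff_mem v E).mp hadd
  haveI : ((E.localMinimalIntegralModel v).baseChange (v.adicCompletion K)).IsMinimal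
      (v.adicCompletionIntegers K) := E.isMinimal_map_localMinimalIntegralModel (v := v)
  haveI : (E.baseChange (v.adicCompletion K)).IsElliptic := by rw [baseChange]; infer_instance
  -- `[X : E₀] = c_v`
  obtain ⟨C, hC⟩ := E.exists_variableChange_eq_localMinimalIntegralModel v
  have hcv := LocalIndex.localTamagawaNumber_eq_index_of_smul_eq_baseChange
    (R := v.adicCompletionIntegers K) (E.baseChange (v.adicCompletion K))
    (E.localMinimalIntegralModel v) C hC
  -- `#Ẽ_ns(k_v) = q_v` (cusp)
  have hΔ0 : ((E.localMinimalIntegralModel v).map (residue (v.adicCompletionIntegers K))).Δ = 0 := by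
    rw [map_Δ, residue_eq_zero_iff]; exact hΔm
  have hc₄0 : ((E.localMinimalIntegralModel v).map (residue (v.adicCompletionIntegers K))).c₄ = 0 := by
    rw [map_c₄, residue_eq_zero_iff]; exact hc₄
  have hcount := (natCard_point_of_Δ_eq_zero
    ((E.localMinimalIntegralModel v).map (residue (v.adicCompletionIntegers K))) hΔ0).2.2 hc₄0
  rw [hcount, ← hcv] at h
  exact h

/-- **Additive reduction, `v ∤ p`, `p ∤ c_v(E)`: `E(K_v)[p^k] = 0`** (Silverman, *AEC* VII.2.1, VII.3.1,
VII.6.1): `#E(K_v)[p^k]` is a power of `p` (Cauchy) dividing `c_v · q_v`, and `p ∤ q_v` (`v ∤ p`). The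
case `p ≥ 5` (`c_v ≤ 4`) is the tree's `natCard_primePowTorsion_eq_one_of_hasAdditiveReductionAt`; this is
the form used at `p = 2` with `c_v` odd. [cite: SilvermanAEC2009, Prop. VII.2.1, Prop. VII.3.1, Thm. VII.6.1]
[cite: SilvermanATAEC1994, Cor. IV.9.2(d)] [cite: Castella2018, Prop. 2.5] -/
theorem natCard_primePowTorsion_eq_one_of_hasAdditiveReductionAt_of_not_dvd
    (hadd : E.HasAdditiveReductionAt v) {p : ℕ} (hp : p.Prime) (hpv : (p : 𝓞 K) ∉ v.asIdeal)
    (hpc : ¬ p ∣ (E.baseChange (v.adicCompletion K)).localTamagawaNumber (v.adicCompletionIntegers K))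
    (k : ℕ) :
    Nat.card (nsmulAddMonoidHom (p ^ k) : (E.baseChange (v.adicCompletion K)).toAffine.Point →+ _).ker
      = 1 := by
  have h := E.natCard_primePowTorsion_dvd_localTamagawaNumber_mul_of_hasAdditiveReductionAt v hadd hpv k
  set T := (nsmulAddMonoidHom (p ^ k) : (E.baseChange (v.adicCompletion K)).toAffine.Point →+ _).ker
    with hT
  have hc0 : (E.baseChange (v.adicCompletion K)).localTamagawaNumber (v.adicCompletionIntegers K) ≠ 0 :=
    fun h0 => hpc (h0 ▸ dvd_zero p)
  have hTne : Nat.card T ≠ 0 := fun h0 => by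
    rw [h0, zero_dvd_iff] at h
    exact (mul_ne_zero hc0 (Nat.card_pos (α := ResidueField (v.adicCompletionIntegers K))).ne') h
  haveI : Finite T := Nat.finite_of_card_ne_zero hTne
  have hpm : ¬ p ∣ (E.baseChange (v.adicCompletion K)).localTamagawaNumber (v.adicCompletionIntegers K) *
      Nat.card (ResidueField (v.adicCompletionIntegers K)) := by
    intro hdvd
    rcases (Nat.Prime.dvd_mul hp).mp hdvd with h1 | h2
    · exact hpc h1
    · exact not_dvd_natCard_residueField' v hp hpv h2
  have hcop := coprime_natCard_of_prime_pow_nsmul_eq_zero' hp (k := k) (fun x : T => Subtype.ext x.2) hpm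
  exact Nat.Coprime.eq_one_of_dvd hcop h

/-- **The same, pointwise: at a place `v ∤ p` of additive reduction with `p ∤ c_v(E)`, every
`P ∈ E(K_v)` with `p^k • P = O` is `O`.** [cite: SilvermanAEC2009, Prop. VII.2.1, Prop. VII.3.1, Thm. VII.6.1] -/
theorem forall_eq_zero_of_prime_pow_smul_eq_zero_of_hasAdditiveReductionAt_of_not_dvd
    (hadd : E.HasAdditiveReductionAt v) {p : ℕ} (hp : p.Prime) (hpv : (p : 𝓞 K) ∉ v.asIdeal)
    (hpc : ¬ p ∣ (E.baseChange (v.adicCompletion K)).localTamagawaNumber (v.adicCompletionIntegers K))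
    (k : ℕ) (P : (E.baseChange (v.adicCompletion K)).toAffine.Point) (hP : (p ^ k) • P = 0) : P = 0 := by
  have h1 := E.natCard_primePowTorsion_eq_one_of_hasAdditiveReductionAt_of_not_dvd v hadd hp hpv hpc k
  have hmem : P ∈ (nsmulAddMonoidHom (p ^ k) :
      (E.baseChange (v.adicCompletion K)).toAffine.Point →+ _).ker := by
    rw [AddMonoidHom.mem_ker, nsmulAddMonoidHom_apply]
    exact hP
  haveI : Finite (nsmulAddMonoidHom (p ^ k) :
      (E.baseChange (v.adicCompletion K)).toAffine.Point →+ _).ker :=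
    Nat.finite_of_card_ne_zero (by rw [h1]; exact one_ne_zero)
  haveI hsub := (Nat.card_eq_one_iff_unique.mp h1).1
  have := Subsingleton.elim (⟨P, hmem⟩ : (nsmulAddMonoidHom (p ^ k) :
      (E.baseChange (v.adicCompletion K)).toAffine.Point →+ _).ker) ⟨0, AddSubgroup.zero_mem _⟩
  exact congrArg Subtype.val this

end WeierstrassCurve

end
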